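import Literature.AlgebraicGeometry.Resolution.MuPTorsorLocalUniformization
import Literature.AlgebraicGeometry.Resolution.ResolutionLU
import Literature.AlgebraicGeometry.Resolution.ZariskiPatchingAllDimensions
import HarnessLib

/-!
# The `μ_p`-torsor case of local uniformization as a way-point to resolution in characteristic `p`

Solo unit `solo-ResolutionOfSingularities-informed`. New assembly around the Literature
reproduction `MuPTorsorLocalUniformization.lean` (Temkin 2013, Rem. 1.3.5 (ii)–(iii) over perfect
ground fields: `Temkin2013 → (LocalUniformizationPerfectInChar p ↔ MuPTorsorLocalUniformization p)`):

* NECESSITY — `muPTorsorLocalUniformization_of_resolutionInChar`,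
  `muPTorsorLocalUniformization_of_resolutionOfSingularities`: the summit (indeed its `p`-conjunct
  `ResolutionInChar p`) implies local uniformization of valuations on `μ_p`-torsors over perfect
  fields. Contrapositive `not_resolutionOfSingularities_of_not_muPTorsor`: ONE valuation on ONE
  degree-`p` purely inseparable extension `K₀(a^{1/p})` of a uniformizable `(K₀, O ∩ K₀)` over a
  perfect field that cannot be uniformized refutes the summit.
* SUFFICIENCY OVER PERFECT FIELDS, GIVEN PATCHING — `hasResolution_of_muPTorsor_of_projPatching`:
  for a perfect field `k` of characteristic `p`, Temkin's inseparable local uniformization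
  (`Temkin2013`, named fact), the `μ_p`-torsor case (`MuPTorsorLocalUniformization p`) and
  two-model patching of projective models over `k` (Piltant 2013, Prop. 5.1 with `P = P_reg`; open
  in dimension `≥ 4`) give weak resolution of every reduced separated `k`-scheme of finite type —
  the `k`-instance of `ResolutionInChar p`. Mechanism: Rem. 1.3.5 gives absolute local
  uniformization over `k` (`MuPTorsorLocalUniformization.localUniformizationPerfect`), and
  Zariski's compactness-and-patching programme in the tree
  (`hasResolution_of_twoModelPatching_of_uniformizable`, `ResolutionOverUpToDim.of_projective`)
  turns absolute local uniformization plus two-model patching into resolution.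

So, over perfect fields, the local half of the summit is EXACTLY the `μ_p`-torsor problem
`t^p = f(x₁, …, x_d)` on (function fields of) regular varieties, in every dimension; what this
file does not touch is (a) imperfect ground fields and (b) patching in dimension `≥ 4`.
-/

noncomputable section

open CategoryTheory AlgebraicGeometry IsLocalRing
open Literature.AlgebraicGeometry Literature.AlgebraicGeometry.Resolution

namespace Summit.ResolutionOfSingularities.ResolutionOfSingularities.Theorems

universe u

/-- **Resolution in characteristic `p` implies local uniformization of valuations on
`μ_p`-torsors** (over perfect ground fields of characteristic `p`): resolution gives Zariski local
uniformization (`ResolutionInChar.localUniformizationInChar`), which restricts to perfect fields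
and to the torsor case. -/
theorem muPTorsorLocalUniformization_of_resolutionInChar {p : ℕ} (h : ResolutionInChar.{u} p) :
    MuPTorsorLocalUniformization.{u} p :=
  h.localUniformizationInChar.perfect.muPTorsor

/-- **The summit implies the `μ_p`-torsor case of local uniformization for every prime `p`.** -/
theorem muPTorsorLocalUniformization_of_resolutionOfSingularities
    (h : Literature.AlgebraicGeometry.Resolution.ResolutionOfSingularities) (p : ℕ)
    (hp : p.Prime) : MuPTorsorLocalUniformization.{0} p :=
  muPTorsorLocalUniformization_of_resolutionInChar (h p hp)

/-- **Kill switch**: a prime `p` for which some valuation on some `μ_p`-torsor extension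
`K₀(a^{1/p})/K₀` of a uniformizable `(K₀, O ∩ K₀)` over a perfect field of characteristic `p`
cannot be uniformized refutes resolution of singularities in positive characteristic. -/
theorem not_resolutionOfSingularities_of_not_muPTorsor {p : ℕ} (hp : p.Prime)
    (h : ¬ MuPTorsorLocalUniformization.{0} p) :
    ¬ Literature.AlgebraicGeometry.Resolution.ResolutionOfSingularities :=
  fun hR => h (muPTorsorLocalUniformization_of_resolutionOfSingularities hR p hp)

/-- **Local uniformization over a perfect field from the `μ_p`-torsor case** (Temkin 2013,
Rem. 1.3.5, the `k`-instance): under `Temkin2013` and `MuPTorsorLocalUniformization p`, every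
valuation ring `O ⊇ k` of a finitely generated extension of a perfect field `k` of characteristic
`p` is locally uniformizable. -/
theorem isLocallyUniformizable_of_muPTorsor {p : ℕ} [Fact p.Prime] (hT : Temkin2013.{u})
    (H : MuPTorsorLocalUniformization.{u} p) {k K : Type u} [Field k] [CharP k p] [PerfectField k]
    [Field K] [Algebra k K] (hfg : (⊤ : IntermediateField k K).FG) (O : ValuationSubring K)
    (hk : ∀ c : k, algebraMap k K c ∈ O) : IsLocallyUniformizable k K O :=
  H.localUniformizationPerfect hT k K hfg O hk

/-- **Resolution over a perfect field of characteristic `p` from: Temkin's inseparable local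
uniformization, the `μ_p`-torsor case of local uniformization, and two-model patching of
projective models over `k`.** For `k` perfect of characteristic `p`: if any two projective models
of every `K/k` essentially of finite type are dominated by a third whose maps do not destroy
regular points (Piltant 2013, Prop. 5.1, `P = P_reg`; known for `trdeg ≤ 3`, open beyond), then
every reduced separated `k`-scheme of finite type has a weak resolution — the `k`-instance of
`ResolutionInChar p`. Proof: Rem. 1.3.5 supplies absolute local uniformization over `k`
(`isLocallyUniformizable_of_muPTorsor`); Zariski's programme
(`hasResolution_of_twoModelPatching_of_uniformizable` on integral projective varieties, then
`ResolutionOverUpToDim.of_projective`, Chow + normalisation bookkeeping) does the rest. -/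
theorem hasResolution_of_muPTorsor_of_projPatching {p : ℕ} [Fact p.Prime] (hT : Temkin2013.{u})
    (H : MuPTorsorLocalUniformization.{u} p) {k : Type u} [Field k] [CharP k p] [PerfectField k]
    (hZ : ∀ (K : Type u) [Field K] [Algebra k K] [Algebra.EssFiniteType k K],
      ∀ M₁ M₂ : ProjModel k K,
        ∃ (N : ProjModel k K) (φ₁ : N.Hom M₁) (φ₂ : N.Hom M₂), φ₁.RegLe ∧ φ₂.RegLe)
    (X : Scheme.{u}) (f : X ⟶ Spec (.of k)) (hs : IsSeparated f) (hl : LocallyOfFiniteType f)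
    (hq : QuasiCompact f) (hr : IsReduced X) : Scheme.HasResolution X := by
  haveI : QuasiCompact f := hq
  haveI : LocallyOfFiniteType f := hl
  haveI : CompactSpace X := QuasiCompact.compactSpace_of_compactSpace f
  obtain ⟨d, hd⟩ := exists_topologicalKrullDim_le_of_locallyOfFiniteType f
  have hU : ∀ (K : Type u) [Field K] [Algebra k K] (A₀ : Subalgebra k K), A₀.FG →
      IsFractionRing A₀ K → ∀ v : ZariskiRiemannSpace k K, ∃ T : Subalgebra k K,
        (T.FG ∧ IsFractionRing T K) ∧ ZariskiRiemannSpace.HasRegularCentre T v := by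
    intro K _ _ A₀ hA₀fg hA₀fr v
    haveI : Algebra.FiniteType k A₀ := A₀.fg_iff_finiteType.mp hA₀fg
    haveI : Algebra.EssFiniteType A₀ K :=
      Algebra.EssFiniteType.of_isLocalization K (nonZeroDivisors A₀)
    have hKfg : (⊤ : IntermediateField k K).FG :=
      IntermediateField.fg_top_iff.mpr (Algebra.EssFiniteType.comp k A₀ K)
    exact exists_hasRegularCentre_of_lu
      (fun O hO => isLocallyUniformizable_of_muPTorsor hT H hKfg O hO) v
  refine ResolutionOverUpToDim.of_projective (k := k) (d := d) (fun _ Y ι hι hint _ => ?_)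
    X f hs hl hq hr hd
  haveI := hι
  haveI := hint
  exact hasResolution_of_twoModelPatching_of_uniformizable hZ hU Y ι

/-- The same, packaged as the `k`-instance of `ResolutionOverUpToDim k d` for every `d`. -/
theorem resolutionOverUpToDim_of_muPTorsor_of_projPatching {p : ℕ} [Fact p.Prime]
    (hT : Temkin2013.{u}) (H : MuPTorsorLocalUniformization.{u} p) {k : Type u} [Field k]
    [CharP k p] [PerfectField k]
    (hZ : ∀ (K : Type u) [Field K] [Algebra k K] [Algebra.EssFiniteType k K],
      ∀ M₁ M₂ : ProjModel k K,
        ∃ (N : ProjModel k K) (φ₁ : N.Hom M₁) (φ₂ : N.Hom M₂), φ₁.RegLe ∧ φ₂.RegLe)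
    (d : ℕ) : ResolutionOverUpToDim k d :=
  fun X f hs hl hq hr _ => hasResolution_of_muPTorsor_of_projPatching hT H hZ X f hs hl hq hr

end Summit.ResolutionOfSingularities.ResolutionOfSingularities.Theorems

end
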